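import Literature.MathematicalPhysics.QuantumFieldTheory.Balaban1983to89.B7SectEFLinearisationRec
import Literature.MathematicalPhysics.QuantumFieldTheory.Balaban1983to89.B7Eq92ConcreteRec
import Literature.MathematicalPhysics.QuantumFieldTheory.Balaban1983to89.B7Prop3GeneralLinear

/-!
# `Balaban1983to89.B7Prop3GeneralLinearRec` — [Balaban1985Averaging] PROPOSITION 3 AT A GENERAL BACKGROUND `V₀`, THE LINEAR PART, file 1 — (110)–(112), (120)–(122), (125) pp. 34–36 — FOR THE
# RECORD's AVERAGING STRUCTURE ([Balaban1987RG1] (0.3)–(0.4)): the block-frame derivatives `±F̂_{V₀}`, the main term (125) with its bound `|(Q₀A)_c| ≤ |A|`, `Q(V₀,0,c) = 0`, and THE FRAME PART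
# OF (120) for the record twins `FcovZ ∕ wframeZ ∕ tildZ ∕ dbavgCovZ ∕ FhatCovZ ∕ Q0covZ ∕ QcovZ ∕ linQcovZ ∕ CcovZ`; plus the exact flat (`V₀ = 1`) identity reductions of (82)∕(89)∕(110)

statement-level skeleton of published theorems with citation tags; proofs where landed; nothing here is a claim about the Yang–Mills mass gap

CITATION HEADER (lean-in-tree rule).  Cell `pub-ymgap`, seat `pub-ymgap-dag-n05-e` g35 (N05-REC LEAD PEN); item R1 ([3] layer) of the road — first file of the Prop. 3 general-background chain
(`B7Prop3GeneralLinear → …Tild → …Analytic → …LinearSplit → …LinearBound → …LinearPdev → B7Eq123General → B7Prop4GeneralLevels`) whose record twins the cell's R4∕R5 ([6] Sect. A–E re-runs) consume.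
`--kind proof --supports stmt-QuantumFields-20541` (K0⁷; count-neutral; no definition).  Sources READ: [3] pp. 34–36 (`paper:balaban1985-cmp98-averaging`) through the engine modules
`B7Prop3GeneralLinear` §3–§5 and `B7Eq92Concrete` (flat reductions), re-run token for token over the record objects (TOKEN RULE: `bavg ↦ bavgZ`, block points `y + boxVec L r ↦ y + offZ L r`,
frame words `treeWord (boxVec L r) ↦ treeWord (offZ L r)` (T3: the record's axial∕frame contours are single staircases re-rooted at the centre), the objects ↦ their `…Z` twins of
`B7SectCDGaugeAveragesRec` ∕ `B7SectEFLinearisationRec`).  The rotated functionals `tsum`, `conjR` and their calculus (`B7Prop3GeneralRotated`, `B7Eq78Linearization`) are REUSED BY NAME.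
NOT twinned here: `linQcov_one_left` (the flat linear part — for the record it carries the curl functional `Φ` of `B7Prop3FlatRec`, LOCATED-N2; road (A′)).
WHAT IS PROVED (sorry-free): §0 `FcovZ_one_left`, `wframeZ_one_left`, `tildZ_one_left`, `dbavgCovZ_one_left` (exact `V₀ = 1` identities); §3 `FhatCovZ_one_left`, ★`hasDerivAt_FcovZ_expCfg`, `FcovZ_expCfg_zero_smul`,
★`hasDerivAt_wframeZ_expCfg`, `hasDerivAt_wframeZ_inv_expCfg`; §4 `tsum_treeWord_segZ`, `Q0covZ_one_left`, ★`norm_Q0covZ_le` (|(Q₀A)_c| ≤ |A|); §5 `QcovZ_one_left`, `tildZ_one_right`, `wframeZ_one_right`, `dbavgCovZ_one_right`,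
★`QcovZ_zero`, `QcovZ_eq_linQcovZ_add_CcovZ`, ★★`hasDerivAt_QcovZ_of_tild` (THE FRAME PART OF (120)), `linQcovZ_eq_of_tild`.
HONEST SCOPE.  Exact identities and the printed elementary bound (125) for OUR typed record objects; `HThm4Rec` UNDISCHARGED; N05 ∕ N07 NOT discharged; counts unmoved (typed 28∕28 · discharged 7∕28);
one finite 𝕋⁴ programme at fixed ε — nothing continuum ∕ ℝ⁴ ∕ OS ∕ mass gap ∕ Clay.  No `def`, no `instance`, no `notation`, no `sorry`.
-/

set_option autoImplicit false

noncomputable section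

open scoped BigOperators
open NormedSpace Finset

namespace Literature.MathematicalPhysics.QuantumFieldTheory.Balaban1983to89.B7Prop3GeneralLinearRec

open B7Prop1Explicit hiding Site
open B7Prop1Explicit renaming Site → SiteZ
open MatrixLog B7AvgGaugeCovariance B7Prop3GeneralRotated
open B7Prop3Flat (expCfg)
open B7Eq92Concrete (Rc Rc_apply Rc_mul Rc_inv_apply Rc_one_apply mgauge mgauge_apply mgauge_mul tHol tHol_nil tHol_mgauge mlog_Rc expUnit_conj tHol_one_left)
open B7Eq78Linearization (conjR conjR_apply conjR_one hasDerivAt_mlog_comp hasDerivAt_exp_comp_zero hasDerivAt_conjR_comp)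
open B8Ineq130 (hol_one)
open BlockAveragingZd (offZ bavgZ avgIterZ avgIterZ_zero avgIterZ_succ bavgZ_one)
open B7SectCDGaugeAveragesRec (FcovZ wframeZ tildZ dbavgCovZ tildIterZ dbavgCovIterZ vcovZ)
open B7SectEFLinearisationRec (FavgZ vframeZ dbavgZ FhatZ linQZ Q0formZ FhatCovZ Q0covZ QcovZ linQcovZ CcovZ)
open B7Eq92ConcreteRec (tildZ_apply dbavgCovZ_apply)

variable {d : ℕ}

variable {𝔸 : Type*} [NormedRing 𝔸] [NormedAlgebra ℂ 𝔸] [CompleteSpace 𝔸]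

/-! ## §0 The exact flat (`V₀ = 1`) identity reductions of (82)∕(89)∕(110) for the record objects -/

section Flat

omit [CompleteSpace 𝔸] in
/-- `FcovZ_one_left`: at `V₀ = 1` the exponent is (110) `F(y) = Σ L^{−d} log V₁(Γ_{y,x})` (`B7Prop3Flat.Favg`).
[cite: Balaban1985Averaging, (110) p.34, (82) p.30] -/
@[simp] theorem FcovZ_one_left (L : ℕ) (V₁ : SiteZ d → Fin d → 𝔸ˣ) (y : SiteZ d) :
    FcovZ L (1 : SiteZ d → Fin d → 𝔸ˣ) V₁ y = FavgZ L V₁ y := by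
  simp [FcovZ, FavgZ]

/-- `wframeZ_one_left`: at `V₀ = 1` the block frame is `B7Prop3Flat.vframe`. [cite: Balaban1985Averaging, (110) p.34, (82) p.30] -/
@[simp] theorem wframeZ_one_left (L : ℕ) (V₁ : SiteZ d → Fin d → 𝔸ˣ) (y : SiteZ d) :
    wframeZ L (1 : SiteZ d → Fin d → 𝔸ˣ) V₁ y = vframeZ L V₁ y := by
  simp [wframeZ, vframeZ]

/-- `tildZ_one_left`: at `V₀ = 1`, `Ṽ₁ = V̄₁` (`1̄ = 1`; cf. (120) p. 35 as read by gen 16 in `B7Prop3Flat.dbavg`).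
[cite: Balaban1985Averaging, (65) p.29, (120) p.35] -/
@[simp] theorem tildZ_one_left (L : ℕ) (V₁ : SiteZ d → Fin d → 𝔸ˣ) :
    tildZ L (1 : SiteZ d → Fin d → 𝔸ˣ) V₁ = bavgZ L V₁ := by
  funext q κ
  simp [tildZ, bavgZ_one]

/-- `dbavgCovZ_one_left`: at `V₀ = 1` the double-bar average (89) is `B7Prop3Flat.dbavg` (`V̄₀ = 1`, `R̄_{0,c} = id`,
`Ṽ₁ = V̄₁`; cf. (120) p. 35 as read by gen 16). [cite: Balaban1985Averaging, (89) p.31, (120) p.35] -/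
@[simp] theorem dbavgCovZ_one_left (L : ℕ) (V₁ : SiteZ d → Fin d → 𝔸ˣ) :
    dbavgCovZ L (1 : SiteZ d → Fin d → 𝔸ˣ) V₁ = dbavgZ L V₁ := by
  funext q κ
  simp [dbavgCovZ_apply, dbavgZ, bavgZ_one]

end Flat

variable (L : ℕ)

/-! ## §3 The block frames: the exponent of (112) at a general background and the derivative of `\overline{R_{0,y}V₁}` -/

section Frames


omit [CompleteSpace 𝔸] in
/-- flat reduction: `F̂_{1} = F̂` of `B7Prop3Flat`. [cite: Balaban1985Averaging, (112) p.34] -/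
@[simp] theorem FhatCovZ_one_left (A : SiteZ d → Fin d → 𝔸) (y : SiteZ d) :
    FhatCovZ L (1 : SiteZ d → Fin d → 𝔸ˣ) A y = FhatZ L A y := by
  simp [FhatCovZ, FhatZ]

/-- **(110)–(112) linearised**: the exponent `F(y) = Σ_x L^{−d} log (R_{0,y}e^{tA})(Γ_{y,x})` of the block frame
(`B7Eq92Concrete.Fcov`) has `t`-derivative `F̂_{V₀}(y)` at `t = 0`. [cite: Balaban1985Averaging, (110)–(112) p.34] -/
theorem hasDerivAt_FcovZ_expCfg (V₀ : SiteZ d → Fin d → 𝔸ˣ) (A : SiteZ d → Fin d → 𝔸) (y : SiteZ d) :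
    HasDerivAt (fun t : ℂ => FcovZ L V₀ (expCfg (t • A)) y) (FhatCovZ L V₀ A y) 0 := by
  unfold FcovZ FhatCovZ
  refine HasDerivAt.fun_sum fun r _ => ?_
  have h := (hasDerivAt_mlog_tHol_expCfg V₀ A y (treeWord (offZ L r))).const_smul (((L : ℝ) ^ d)⁻¹)
  exact h

/-- the exponent (110) vanishes at `t = 0` (`log 1 = 0` termwise). [cite: Balaban1985Averaging, (110) p.34] -/
theorem FcovZ_expCfg_zero_smul (V₀ : SiteZ d → Fin d → 𝔸ˣ) (A : SiteZ d → Fin d → 𝔸) (y : SiteZ d) :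
    FcovZ L V₀ (expCfg ((0 : ℂ) • A)) y = 0 := by
  unfold FcovZ
  exact Finset.sum_eq_zero fun r _ => by rw [tHol_expCfg_zero_smul, Units.val_one, mlog_one, smul_zero]

/-- **the block frame `\overline{R_{0,y}e^{tA}}` has derivative `F̂_{V₀}(y)` at `t = 0`** (`exp` through `0`:
`B7Eq78Linearization.hasDerivAt_exp_comp_zero`). [cite: Balaban1985Averaging, (110)–(112) p.34] -/
theorem hasDerivAt_wframeZ_expCfg (V₀ : SiteZ d → Fin d → 𝔸ˣ) (A : SiteZ d → Fin d → 𝔸) (y : SiteZ d) :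
    HasDerivAt (fun t : ℂ => ((wframeZ L V₀ (expCfg (t • A)) y : 𝔸ˣ) : 𝔸)) (FhatCovZ L V₀ A y) 0 := by
  simp only [wframeZ, val_expUnit]
  exact hasDerivAt_exp_comp_zero (FcovZ_expCfg_zero_smul L V₀ A y) (hasDerivAt_FcovZ_expCfg L V₀ A y)

/-- … and its inverse `(\overline{R_{0,y}e^{tA}})⁻¹ = exp(−F(y))` has derivative `−F̂_{V₀}(y)` (the frame
`(\overline{R_{0,c₋}V₁})⁻¹` of (89)/(120)). [cite: Balaban1985Averaging, (120) p.35, (89) p.31] -/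
theorem hasDerivAt_wframeZ_inv_expCfg (V₀ : SiteZ d → Fin d → 𝔸ˣ) (A : SiteZ d → Fin d → 𝔸) (y : SiteZ d) :
    HasDerivAt (fun t : ℂ => (((wframeZ L V₀ (expCfg (t • A)) y)⁻¹ : 𝔸ˣ) : 𝔸)) (-FhatCovZ L V₀ A y) 0 := by
  simp only [wframeZ, val_inv_expUnit, val_expUnit]
  exact hasDerivAt_exp_comp_zero (by rw [FcovZ_expCfg_zero_smul, neg_zero]) (hasDerivAt_FcovZ_expCfg L V₀ A y).neg

end Frames

section MainTerm


omit [NormedAlgebra ℂ 𝔸] [CompleteSpace 𝔸] in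
/-- the summand of (125) IS the segment piece of the rotated functional along `Γ_{c₋,x} ∪ [x, x′]`:
`(R_{0,c₋}A)(Γ_{c₋,x} ∪ [x,x′]) = (R_{0,c₋}A)(Γ_{c₋,x}) + R(V₀(Γ_{c₋,x}))(R_{0,x}A)([x,x′])`. [cite: Balaban1985Averaging, (125) p.36, (115) p.34] -/
theorem tsum_treeWord_segZ (V₀ : SiteZ d → Fin d → 𝔸ˣ) (A : SiteZ d → Fin d → 𝔸) (q : SiteZ d) (κ : Fin d)
    (r : Fin d → Fin L) :
    tsum V₀ A q (treeWord (offZ L r) ++ seg κ L)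
      = tsum V₀ A q (treeWord (offZ L r))
        + conjR (hol V₀ q (treeWord (offZ L r))) (tsum V₀ A (q + offZ L r) (seg κ L)) := by
  rw [tsum_append, disp_treeWord]

omit [CompleteSpace 𝔸] in
/-- flat reduction: `Q₀` at `V₀ = 1` is `B7Prop3Flat.Q0form` ((125) with `R_{0,c₋} = id`). [cite: Balaban1985Averaging, (125) p.36] -/
@[simp] theorem Q0covZ_one_left (A : SiteZ d → Fin d → 𝔸) (q : SiteZ d) (κ : Fin d) :
    Q0covZ L (1 : SiteZ d → Fin d → 𝔸ˣ) A q κ = Q0formZ L A q κ := by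
  simp [Q0covZ, Q0formZ, hol_one, conjR_apply]

omit [CompleteSpace 𝔸] in
/-- **"and it has an estimate |(Q₀A)_c| ≤ |A| < α₁"** (display after (125)), at a general background with
`‖V₀(b)‖, ‖V₀(b)⁻¹‖ ≤ 1`: each of the `L^d` sites contributes `L` rotated bond variables of norm `≤ a`, weighted
`L^{−(d+1)}`. [cite: Balaban1985Averaging, (125)–(126) p.36] -/
theorem norm_Q0covZ_le [NormOneClass 𝔸] (hL : 1 ≤ L) {V₀ : SiteZ d → Fin d → 𝔸ˣ} (hV₀ : ∀ x κ, V₀ x κ ∈ U1 𝔸)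
    {A : SiteZ d → Fin d → 𝔸} {a : ℝ} (hA : ∀ x κ, ‖A x κ‖ ≤ a) (q : SiteZ d) (κ : Fin d) :
    ‖Q0covZ L V₀ A q κ‖ ≤ a := by
  have hLpos : (0 : ℝ) < L := by exact_mod_cast hL
  unfold Q0covZ
  calc ‖∑ r : Fin d → Fin L, (((L : ℝ) ^ (d + 1))⁻¹) •
          conjR (hol V₀ q (treeWord (offZ L r))) (tsum V₀ A (q + offZ L r) (seg κ L))‖
      ≤ ∑ r : Fin d → Fin L, (((L : ℝ) ^ (d + 1))⁻¹) * (L * a) := by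
        refine norm_sum_le_of_le _ fun r _ => ?_
        rw [norm_smul, Real.norm_of_nonneg (by positivity)]
        refine mul_le_mul_of_nonneg_left ?_ (by positivity)
        refine (norm_conjR_le (hol_mem hV₀ _ _) _).trans ?_
        have h := norm_tsum_le hV₀ hA (q + offZ L r) (seg κ L)
        rwa [length_seg, Int.natAbs_natCast] at h
    _ = a := by
        rw [Finset.sum_const, Finset.card_univ, Fintype.card_pi, Finset.prod_const, Finset.card_univ,
          Fintype.card_fin, Fintype.card_fin, nsmul_eq_mul, Nat.cast_pow, pow_succ]
        field_simp

end MainTerm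

section Objects


/-- flat reduction of (121). [cite: Balaban1985Averaging, (121) p.36] -/
theorem QcovZ_one_left (A : SiteZ d → Fin d → 𝔸) (q : SiteZ d) (κ : Fin d) :
    QcovZ L (1 : SiteZ d → Fin d → 𝔸ˣ) A q κ = mlog ((dbavgZ L (expCfg A) q κ : 𝔸ˣ) : 𝔸) := by
  rw [QcovZ, dbavgCovZ_one_left]

/-- `Ṽ₁ = 1` for `V₁ = 1` ((65): `(\overline{1·V₀})_c(V̄₀)_c⁻¹ = 1`). [cite: Balaban1985Averaging, (65) p.29, (113) p.34] -/
theorem tildZ_one_right (V₀ : SiteZ d → Fin d → 𝔸ˣ) (q : SiteZ d) (κ : Fin d) :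
    tildZ L V₀ (1 : SiteZ d → Fin d → 𝔸ˣ) q κ = 1 := by
  rw [tildZ_apply, one_mul, mul_inv_cancel]

/-- the block frame (110) of the unit configuration is `1` (every twisted transport of `1` is `1`). [cite: Balaban1985Averaging, (110) p.34] -/
theorem wframeZ_one_right (V₀ : SiteZ d → Fin d → 𝔸ˣ) (y : SiteZ d) :
    wframeZ L V₀ (1 : SiteZ d → Fin d → 𝔸ˣ) y = 1 := by
  have h : FcovZ L V₀ (1 : SiteZ d → Fin d → 𝔸ˣ) y = 0 := by
    have := FcovZ_expCfg_zero_smul L V₀ (0 : SiteZ d → Fin d → 𝔸) y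
    rwa [zero_smul, expCfg_zero] at this
  exact Units.ext (by rw [wframeZ, val_expUnit, h, exp_zero, Units.val_one])

/-- **`V̿₁ = 1` at `V₁ = 1`**: the double-bar average of the unit configuration is the unit, at EVERY background.
[cite: Balaban1985Averaging, (89) p.31] -/
theorem dbavgCovZ_one_right (V₀ : SiteZ d → Fin d → 𝔸ˣ) (q : SiteZ d) (κ : Fin d) :
    dbavgCovZ L V₀ (1 : SiteZ d → Fin d → 𝔸ˣ) q κ = 1 := by
  rw [dbavgCovZ_apply, wframeZ_one_right, wframeZ_one_right, tildZ_one_right, inv_one, one_mul, one_mul, map_one]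

/-- **`Q(V₀, 0, c) = 0`**: the Taylor expansion of (121) has no constant term ("from (120) it follows that its Taylor
expansion begins with a first-order polynomial"). [cite: Balaban1985Averaging, (121)–(122) p.36] -/
theorem QcovZ_zero (V₀ : SiteZ d → Fin d → 𝔸ˣ) (q : SiteZ d) (κ : Fin d) :
    QcovZ L V₀ (0 : SiteZ d → Fin d → 𝔸) q κ = 0 := by
  rw [QcovZ, expCfg_zero, dbavgCovZ_one_right, Units.val_one, mlog_one]

/-- **(122)** "Q(V₀, A, c) = L(Q(V₀)A)_c + C(V₀, A, c)" (by the definition of `Ccov`). [cite: Balaban1985Averaging, (122) p.36] -/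
theorem QcovZ_eq_linQcovZ_add_CcovZ (V₀ : SiteZ d → Fin d → 𝔸ˣ) (A : SiteZ d → Fin d → 𝔸) (q : SiteZ d) (κ : Fin d) :
    QcovZ L V₀ A q κ = linQcovZ L V₀ A q κ + CcovZ L V₀ A q κ := by
  rw [CcovZ, add_sub_cancel]

/-- **THE FRAME PART OF (120)/(124).**  Along `V₁ = e^{tA}` the double-bar average (89)
`V̿₁(c) = (\overline{R_{0,c₋}V₁})⁻¹ · Ṽ₁(c) · R̄_{0,c}\overline{R_{0,c₊}V₁}` passes through `1` at `t = 0`, and the two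
frames contribute `−F̂_{V₀}(c₋)` and `R̄_{0,c}F̂_{V₀}(c₊)` to its derivative: IF `Ṽ₁(c)` has `t`-derivative `D` at `0`
then `Q(V₀, tA, c)` has `t`-derivative `−F̂_{V₀}(c₋) + D + R̄_{0,c}F̂_{V₀}(c₊)` — the first and third terms of the exponent
of (120) ("−i Σ_{x∈B(c₋)} L^{−d}(R_{0,c₋}A)(Γ_{c₋,x}) + i(Q′(V₀)A)_c + i Σ_{x′∈B(c₊)} L^{−d} R̄_{0,c}(R_{0,c₊}A)(Γ_{c₊,x′})"),
the middle one `(Q′(V₀)A)_c` (113)–(119) being `D`, the sequel's. [cite: Balaban1985Averaging, (120) p.35, (89) p.31] -/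
theorem hasDerivAt_QcovZ_of_tild (V₀ : SiteZ d → Fin d → 𝔸ˣ) (A : SiteZ d → Fin d → 𝔸) (q : SiteZ d) (κ : Fin d)
    {D : 𝔸} (hD : HasDerivAt (fun t : ℂ => ((tildZ L V₀ (expCfg (t • A)) q κ : 𝔸ˣ) : 𝔸)) D 0) :
    HasDerivAt (fun t : ℂ => QcovZ L V₀ (t • A) q κ)
      (-FhatCovZ L V₀ A q + D + conjR (bavgZ L V₀ q κ) (FhatCovZ L V₀ A (q + (L : ℤ) • e κ))) 0 := by
  have h1 := hasDerivAt_wframeZ_inv_expCfg L V₀ A q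
  have h3 := hasDerivAt_conjR_comp (bavgZ L V₀ q κ) (hasDerivAt_wframeZ_expCfg L V₀ A (q + (L : ℤ) • e κ))
  have h := (h1.fun_mul hD).fun_mul h3
  -- values at `t = 0`: every factor is `1`
  have e1 : (((wframeZ L V₀ (expCfg ((0 : ℂ) • A)) q)⁻¹ : 𝔸ˣ) : 𝔸) = 1 := by
    rw [zero_smul, expCfg_zero, wframeZ_one_right, inv_one, Units.val_one]
  have e2 : ((tildZ L V₀ (expCfg ((0 : ℂ) • A)) q κ : 𝔸ˣ) : 𝔸) = 1 := by
    rw [zero_smul, expCfg_zero, tildZ_one_right, Units.val_one]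
  have e3 : conjR (bavgZ L V₀ q κ) ((wframeZ L V₀ (expCfg ((0 : ℂ) • A)) (q + (L : ℤ) • e κ) : 𝔸ˣ) : 𝔸) = 1 := by
    rw [zero_smul, expCfg_zero, wframeZ_one_right, Units.val_one, conjR_one]
  simp only [e1, e2, e3, mul_one, one_mul] at h
  have hval : ∀ t : ℂ, QcovZ L V₀ (t • A) q κ
      = mlog ((((wframeZ L V₀ (expCfg (t • A)) q)⁻¹ : 𝔸ˣ) : 𝔸) * ((tildZ L V₀ (expCfg (t • A)) q κ : 𝔸ˣ) : 𝔸)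
          * conjR (bavgZ L V₀ q κ) ((wframeZ L V₀ (expCfg (t • A)) (q + (L : ℤ) • e κ) : 𝔸ˣ) : 𝔸)) := by
    intro t
    rw [QcovZ, dbavgCovZ_apply, Units.val_mul, Units.val_mul, conjR_apply, Rc_apply, Units.val_mul, Units.val_mul]
  simp_rw [hval]
  refine hasDerivAt_mlog_comp ?_ h
  rw [e1, e2, e3, mul_one, mul_one]

/-- hence, in `deriv` form: «L(Q(V₀)A)_c» `= −F̂_{V₀}(c₋) + D + R̄_{0,c}F̂_{V₀}(c₊)` whenever `Ṽ₁` has derivative `D`.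
[cite: Balaban1985Averaging, (120) p.35, (122) p.36] -/
theorem linQcovZ_eq_of_tild (V₀ : SiteZ d → Fin d → 𝔸ˣ) (A : SiteZ d → Fin d → 𝔸) (q : SiteZ d) (κ : Fin d)
    {D : 𝔸} (hD : HasDerivAt (fun t : ℂ => ((tildZ L V₀ (expCfg (t • A)) q κ : 𝔸ˣ) : 𝔸)) D 0) :
    linQcovZ L V₀ A q κ = -FhatCovZ L V₀ A q + D + conjR (bavgZ L V₀ q κ) (FhatCovZ L V₀ A (q + (L : ℤ) • e κ)) :=
  (hasDerivAt_QcovZ_of_tild L V₀ A q κ hD).deriv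

end Objects

end Literature.MathematicalPhysics.QuantumFieldTheory.Balaban1983to89.B7Prop3GeneralLinearRec
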